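import Summits.CriticalPhenomena.PercolationContinuityZ3.Theorems.PercAnnulusCrossingSlabRSWCase2
import Literature.Probability.Percolation.SlabRSWTheorem314Case3
import HarnessLib

/-!
# RSW3 lane (p2 GEN 40): NTW's Theorem 3.1 at `p_c(S_k)` with Case 2 AND the exploration step of
# Case 3 of Theorem 3.14 discharged — the box-crossing property from the gluing step `(H316)` and (3.60)

builds on p205010 (kernel theorem, internal audit signed; external expert review pending) — NOT used in this file.

Cell `prim-rsw3` (LANE 3), seat p2, gen 40.  Support file (`--supports stmt-CriticalPhenomena-4575`); no definitions, no named
facts, no sorries.  `boxCrossingProperty_slabCritical_of_case3` (this gen, p459187) reduced NTW's box-crossing property at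
`p_c(S_k)` to `(H3)` (Case 3 of Thm 3.14 for `𝓑₂ = NTW17.evCase2 k ρ₂`) and `(H360)`.  The Literature port of this gen
(`SlabRSWExploration.lean` p464333 = NTW (3.47)–(3.49), the exploration of `𝒞` as a stopping set;
`SlabRSWTheorem314Case3.lean` = `NTW17.thm314_hCase3_of`) splits `(H3)` into the PROVED exploration inequality and the
remaining gluing step `(H316)` (the separation topology of `γ ∪ γ'` + Lemma 3.16), stated over the tree's
`GlueData.evOff` / `GlueData.explored` in the reflected frame `NTW17.case2Setup n`:

* `boxCrossingProperty_slabCritical_of_lemma316` — for `k ≥ 1`, `ρ₂ ≥ 2`: `(H316)` at `p_c(S_k)` and `(H360)` imply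
  `NTW17.BoxCrossingProperty k (p_c(S_k))`.

What remains for NTW's Theorem 3.1 (`NewmanTassionWu2017_thm31`) on this branch: `(H316)` (for an admissible explored set
`𝒞(ω)`: `x ≤ P[C ⟷^{R'∖𝒞(ω)} 𝖡] ⇒ y ≤ f(14n,13n)` — NTW: the path meets `γ'` first (planar separation by `γ ∪ γ'`),
then GL0 in `K_□`, Lemma 3.16) and `(H360)` (the lead's `h360_of`: Thm 3.8 / 3.10 / 3.17 inputs).

References: C. M. Newman, V. Tassion, W. Wu, *Critical percolation and the minimal spanning tree in slabs*, Comm. Pure Appl. Math. 70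
(2017) = arXiv:1512.09107, §3.5 (proof of Theorem 3.14, Case 3, (3.47)–(3.52)), Lemma 3.16, §3.7 [NewmanTassionWu2017].
-/

noncomputable section

namespace Summit.CriticalPhenomena.PercolationContinuityZ3.Theorems.Crossing

open MeasureTheory
open Literature.Probability.Percolation Literature.Probability.LatticeModels
open Literature.Probability.Percolation.NTW17

/-- **NTW's Theorem 3.1 at `p_c(S_k)` from the gluing step `(H316)` of Theorem 3.14, Case 3, and the upper bound (3.60)**
(Case 2 discharged by `NTW17.thm314_hCase2`, the exploration of Case 3 by `NTW17.thm314_hCase3_of`).  For `k ≥ 1` and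
`ρ₂ ≥ 2`: if (H316) — for every `x > 0` there are `y > 0`, `n₃` such that for `n ≥ n₃` and every lattice configuration `ω`
of the reflected frame `Q = (case2Setup n).Q` with `A ⟷^{S'} B`, `𝖡 ⟷^{R'} C`, not `C ⟷^{R'} A`, not
`C̄ ⟷^{R̄'} 𝒩(Γ̄, ρ₂)`, `x ≤ P[C ⟷^{R' ∖ 𝒞(ω)} 𝖡]` implies `y ≤ f(14n,13n)` — holds at `p = p_c(S_k)`, and (H360)
`f_{p_c(S_k)}(n,2n) ≤ 1 - c₂` for `n ≥ 1`, then the box-crossing property holds at `p_c(S_k)`.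
[cite: NewmanTassionWu2017, Theorem 3.1, Theorem 3.14 (Case 3, (3.47)–(3.52)), Lemma 3.16 and §3.7] -/
theorem boxCrossingProperty_slabCritical_of_lemma316 (k : ℕ) (hk : 1 ≤ k) {ρ₂ : ℕ} (hρ₂ : 2 ≤ ρ₂)
    (h316 : ∀ x : ℝ, 0 < x → ∃ y : ℝ, 0 < y ∧ ∃ n₃ : ℕ, ∀ n : ℕ, n₃ ≤ n → ∀ hn : 1 ≤ n,
      ∀ ω : BondConfig (slab 3 k), ω ⊆ (slabGraph 3 k).edgeSet →
      ω ∈ (case2Setup n hn).Q.evAB k → ω ∈ slabConn k (case2Setup n hn).R {z | z.2 = 0} (case2Setup n hn).C →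
      ω ∉ (case2Setup n hn).Q.evCA k → ω ∉ (case2Setup n hn).Q.evNear k ρ₂ →
      x ≤ (bondPercolation (slabGraph 3 k) (criticalProbIOf (slabGraph 3 k) (slabOrigin 3 k))).real
        ((case2Setup n hn).Q.evOff k {z | z.2 = 0} ((case2Setup n hn).Q.explored k ρ₂ ω)) →
      y ≤ (bondPercolation (slabGraph 3 k) (criticalProbIOf (slabGraph 3 k) (slabOrigin 3 k))).real
        (slabConn k (boxR 0 (14 * n) 0 (13 * n)) {z | z.1 = 0} {z | z.1 = 14 * n}))
    (h360 : ∃ c₂ : ℝ, 0 < c₂ ∧ ∀ n : ℕ, 1 ≤ n →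
      (bondPercolation (slabGraph 3 k) (criticalProbIOf (slabGraph 3 k) (slabOrigin 3 k))).real
        (slabConn k (boxR 0 n 0 (2 * n)) {z | z.1 = 0} {z | z.1 = n}) ≤ 1 - c₂) :
    BoxCrossingProperty k (criticalProbIOf (slabGraph 3 k) (slabOrigin 3 k)) :=
  boxCrossingProperty_slabCritical_of_case3 k hk hρ₂ (thm314_hCase3_of _ h316) h360

end Summit.CriticalPhenomena.PercolationContinuityZ3.Theorems.Crossing

end
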